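/-
Copyright (c) 2026 the pub-hodgecm-mathlib formalisation cell (harness21).  Prover seat hodgecm-mathlib-LH5-p02 (g2): line LH4 (Shalika pay-down of the print row
`stub_N6nsShalika`), brick «REG-CENT» for organ ‹RAO› ∕ CENT-BDD (LH4-plan (g2) DEAL BY NAME 2026-09-02T04:31:46Z); 2026-09-02.
-/
import Literature.NumberTheory.Automorphic.UnitaryThreeUnipotentCentralizers     -- ★ (F0P3a-p08 (g17)): `G_{n(t)} = S·N` (the SINGULAR case), `diagonal_mem_unitaryGroupOfForm_three_iff`, `exists_units_coe_eq_torusS`; brings ★ `UnitaryThreeSingularUnipotentClasses` (`mem_unitaryGroupOfForm_iff_of_coe_eq_upperUnipotent`, `B₀_three_apply`)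
import Literature.NumberTheory.Automorphic.UnitaryThreeRegularUnipotentClass      -- ★ (F0P3a-p08 (g17)): Prop. 3.9.1, the normal form `u(1, −t₀)` of a regular unipotent; `exists_units_coe_eq_upperTriangularUnipotent`
import HarnessLib

/-!
# The centraliser of a REGULAR unipotent `u = u(1, −t₀)` in `U(3)`: `G_u = Z·C_N(u)` (Rogawski 1990, §3.9 p. 32)

Topic `NumberTheory/Automorphic`; namespace `Literature.NumberTheory.Automorphic.UnitaryGroup`.  THEOREMS ONLY (no definition, no instance, no notation, no named fact,
no `sorry`); kernel lane `--supports stmt-HodgeConjecture-24833`.  Cell `pub/hodgecm-mathlib` (D-0151), crux H413 = `stmt-HodgeConjecture-24833`; half A line LH4 (closer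
stub `stub_N6ns`, post-ED. 39 print row `stub_N6nsShalika`), pay-down skeleton cand `F0_P3c_ShalikaPaydown` (LH4-plan (g2)); brick **«REG-CENT»** = the REGULAR case of
organ CENT-BDD (LH4-p03 (g3): «every element of `G_u` lies in a compact subgroup», the unimodularity input of ‹RAO›).  Sequel of ★ `UnitaryThreeUnipotentCentralizers`
(§2 there: the SINGULAR case `G_{n(t)} = S·N`) and ★ `UnitaryThreeRegularUnipotentClass` (Prop. 3.9.1: every regular unipotent of `U(σ, J₀)` is conjugate to
`u(1, −t₀) = (1, 1, −t₀; 0, 1, −1; 0, 0, 1)`, `t₀ + σt₀ = 1`, when `2 ≠ 0`).  Elementary matrix algebra; characteristic-free (no `2 ≠ 0`, no `t₀ + σt₀ = 1` below).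
HONEST LABEL: HC_CM is proved only modulo the 7 printed citations (2 remaining named inputs: hLiu418 = stmt-HodgeConjecture-24832, h413 = stmt-HodgeConjecture-24833)
until rung 0 closes; count-neutral brick.

SETTING: any field `K`, ring endomorphism `σ` (an involution where stated), `J₀ = (StdForm.antidiagonal 3).over K`, `U(σ, J₀) =` ★ `unitaryGroupOfForm σ J₀`, the regular
unipotent `u = u(1, −t₀)` with matrix `(1, 1, −t₀; 0, 1, −1; 0, 0, 1)` (any `t₀`), `N` = upper unitriangular, `u(a, b) = (1, a, b; 0, 1, −σa; 0, 0, 1)` (`N ∩ U`: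
`b + σb + aσa = 0`, ★ `mem_unitaryGroupOfForm_iff_of_coe_eq_upperUnipotent`).
* §1 (any `g ∈ M₃(K)`) **`mul_regularUnipotent_eq_regularUnipotent_mul_iff`** — `g·u = u·g ↔ g₁₀ = g₂₀ = g₂₁ = 0 ∧ g₁₁ = g₀₀ ∧ g₂₂ = g₀₀ ∧ g₁₂ = −g₀₁`: the
  `M₃(K)`-centraliser of the regular nilpotent `u − 1` is `K[u − 1] = {a + b(u − 1) + c(u − 1)²}` (`g₀₂` free).
* §2 (`σ² = 1`) **`exists_coe_eq_smul_upperUnipotent_of_commute_regularUnipotent`** — «`G_u = Z·C_N(u)`»: a `g ∈ U(σ, J₀)` commuting with `u` is `z • u(a, b)` with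
  `σz·z = 1` (so `z·1 ∈ Z(U) ≅ U(1)`), `u(a, b) ∈ N ∩ U` and `σa = a` (so `u(a, b)` commutes with `u`); conversely **`smul_upperUnipotent_mem_unitaryGroupOfForm_and_commute`**;
  and the factorisation with both factors as units of `M₃(K)` in `U(σ, J₀)`: **`exists_eq_scalar_mul_upperUnipotent_of_commute_regularUnipotent`** (`g = s·n`,
  `s = diag(z, z, z) ∈ Z(U)`, `n = u(a, b) ∈ C_{N ∩ U}(u)`).

## References
* [Rogawski1990] J. D. Rogawski, *Automorphic Representations of Unitary Groups in Three Variables*, Ann. of Math. Stud. 123 (1990): §1.10 p. 9 (`Z`, `N`, `u(x, z)`),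
  §3.9 p. 32 and Proposition 3.9.1 (regular unipotent classes; centralisers `G_u`), §8.1 p. 112 (where `G_u` enters the unipotent orbital integrals).
* [Mok2014] C. P. Mok, *Endoscopic classification of representations of quasi-split unitary groups*, Mem. AMS 235 (2015): §1 Notation p. 5 (the form `J_N`).
-/

set_option autoImplicit false

open Matrix

namespace Literature.NumberTheory.Automorphic.UnitaryGroup

open Literature.NumberTheory.Automorphic.HermitianLattice

variable {K : Type*} [Field K] (σ : K →+* K)

/-! ## §1 The centraliser of the regular unipotent `u(1, −t₀)` in `M₃(K)` -/

/-- **THE `M₃(K)`-CENTRALISER OF THE REGULAR UNIPOTENT `u = (1, 1, −t₀; 0, 1, −1; 0, 0, 1)`**: `g·u = u·g` iff `g` is upper triangular with constant diagonal and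
`g₁₂ = −g₀₁` — i.e. `g = g₀₀ + g₀₁·(u − 1) + c·(u − 1)²`, the polynomials in the regular nilpotent `u − 1` (whose `M₃`-centraliser is `K[u − 1]`).
[cite: Rogawski1990, §3.9 p. 32] -/
theorem mul_regularUnipotent_eq_regularUnipotent_mul_iff (t₀ : K) (g : Matrix (Fin 3) (Fin 3) K) :
    g * !![1, 1, -t₀; 0, 1, -1; 0, 0, 1] = !![1, 1, -t₀; 0, 1, -1; 0, 0, 1] * g ↔
      g 1 0 = 0 ∧ g 2 0 = 0 ∧ g 2 1 = 0 ∧ g 1 1 = g 0 0 ∧ g 2 2 = g 0 0 ∧ g 1 2 = -g 0 1 := by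
  constructor
  · intro h
    have e := fun i j => congr_fun (congr_fun h i) j
    have h00 := e 0 0
    have h10 := e 1 0
    have h01 := e 0 1
    have h11 := e 1 1
    have h02 := e 0 2
    have h12 := e 1 2
    simp [Matrix.mul_apply, Fin.sum_univ_three] at h00 h10 h01 h11 h02 h12
    -- `h10 : g₂₀ = 0`, `h00 : g₀₀ = g₀₀ + g₁₀ − t₀ g₂₀`, `h11 : g₁₀ + g₁₁ = g₁₁ − g₂₁`, `h01 : g₀₀ + g₀₁ = g₀₁ + g₁₁ − t₀ g₂₁`,
    -- `h12 : −g₁₀ t₀ − g₁₁ + g₁₂ = g₁₂ − g₂₂`, `h02 : −g₀₀ t₀ − g₀₁ + g₀₂ = g₀₂ + g₁₂ − t₀ g₂₂`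
    have g20 : g 2 0 = 0 := h10
    have g10 : g 1 0 = 0 := by linear_combination -h00 + t₀ * g20
    have g21 : g 2 1 = 0 := by linear_combination h11 - g10
    have g11 : g 1 1 = g 0 0 := by linear_combination -h01 + t₀ * g21
    have g22 : g 2 2 = g 0 0 := by linear_combination h12 + t₀ * g10 + g11
    have g12 : g 1 2 = -g 0 1 := by linear_combination -h02 + t₀ * g22
    exact ⟨g10, g20, g21, g11, g22, g12⟩
  · rintro ⟨g10, g20, g21, g11, g22, g12⟩
    ext i j
    fin_cases i <;> fin_cases j <;> (simp [Matrix.mul_apply, Fin.sum_univ_three, g10, g20, g21, g11, g22, g12]; try ring)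

/-! ## §2 `G_u = Z·C_N(u)` in `U(σ, J₀)` for the regular unipotent `u = u(1, −t₀)` -/

/-- **«`G_u = Z·C_N(u)`» FOR THE REGULAR UNIPOTENT `u = u(1, −t₀)`** ([Rogawski1990] §3.9, `σ` an involution): a `g ∈ U(σ, J₀)` commuting with `u` is
`z • u(a, b)` with `σz·z = 1` (so the scalar `z·1` lies in the centre `Z(U) ≅ U(1)`), `u(a, b) = (1, a, b; 0, 1, −σa; 0, 0, 1) ∈ N ∩ U(σ, J₀)` (`b + σb + aσa = 0`)
and `σa = a` (equivalently: `u(a, b)` commutes with `u`).  PROOF: §1 makes `g` upper triangular with constant diagonal `z = g₀₀` and `g₁₂ = −g₀₁`; unitarity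
(`B₀(g e₀, g e₂) = B₀(e₀, e₂) = 1`) gives `σz·z = 1`; `diag(z)⁻¹·g` is an upper unitriangular element of `U(σ, J₀)`, hence `u(a, b)` with `−σa = ` its `(1,2)` entry
`= −a` (★ `mem_unitaryGroupOfForm_iff_of_coe_eq_upperUnipotent`). [cite: Rogawski1990, §3.9 p. 32; §1.10 p. 9] -/
theorem exists_coe_eq_smul_upperUnipotent_of_commute_regularUnipotent (hσ : ∀ z : K, σ (σ z) = z) {t₀ : K} {u g : GL (Fin 3) K}
    (hu : (u : Matrix (Fin 3) (Fin 3) K) = !![1, 1, -t₀; 0, 1, -1; 0, 0, 1]) (hg : g ∈ unitaryGroupOfForm σ ((StdForm.antidiagonal 3).over K))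
    (hcomm : g * u = u * g) :
    ∃ z a b : K, σ z * z = 1 ∧ σ a = a ∧ b + σ b + a * σ a = 0 ∧
      (g : Matrix (Fin 3) (Fin 3) K) = z • !![1, a, b; 0, 1, -σ a; 0, 0, 1] := by
  set G : Matrix (Fin 3) (Fin 3) K := (g : Matrix (Fin 3) (Fin 3) K) with hG
  have hcomm' : G * !![1, 1, -t₀; 0, 1, -1; 0, 0, 1] = !![1, 1, -t₀; 0, 1, -1; 0, 0, 1] * G := by
    rw [hG, ← hu, ← Units.val_mul, hcomm, Units.val_mul]
  obtain ⟨h10, h20, h21, h11, h22, h12⟩ := (mul_regularUnipotent_eq_regularUnipotent_mul_iff t₀ G).1 hcomm'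
  have hinv := (mem_unitaryGroupOfForm_antidiagonal_iff (σ := σ) (N := 3) g).1 hg
  have hGe : ∀ i j, (G *ᵥ Pi.single j 1) i = G i j := fun i j => by rw [Matrix.mulVec_single_one]; rfl
  -- the norm condition on the (constant) diagonal: `σz·z = 1`, `z = g₀₀`
  have hz : σ (G 0 0) * G 0 0 = 1 := by
    have h := hinv (Pi.single 0 1) (Pi.single 2 1)
    rw [B₀_three_apply, B₀_three_apply, hGe, hGe, hGe, hGe, hGe, hGe, h10, h20, h22] at h
    simpa using h
  have hz0 : G 0 0 ≠ 0 := right_ne_zero_of_mul_eq_one hz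
  -- `n := diag(z)⁻¹ · g` is upper unitriangular and unitary
  obtain ⟨m, hm, hm'⟩ := exists_units_coe_eq_torusS (K := K) hz0 hz0
  have hmU : m ∈ unitaryGroupOfForm σ ((StdForm.antidiagonal 3).over K) :=
    (diagonal_mem_unitaryGroupOfForm_three_iff σ hm).2 ⟨hz, hz, hz⟩
  have hn : ((m⁻¹ * g : GL (Fin 3) K) : Matrix (Fin 3) (Fin 3) K) =
      !![1, (G 0 0)⁻¹ * G 0 1, (G 0 0)⁻¹ * G 0 2; 0, 1, -((G 0 0)⁻¹ * G 0 1); 0, 0, 1] := by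
    rw [Units.val_mul, hm', ← hG]
    ext i j
    fin_cases i <;> fin_cases j <;> simp [Matrix.diagonal_mul, h10, h20, h21, h11, h22, h12, hz0]
  have hnU : m⁻¹ * g ∈ unitaryGroupOfForm σ ((StdForm.antidiagonal 3).over K) := mul_mem (inv_mem hmU) hg
  obtain ⟨hc, hb⟩ := (mem_unitaryGroupOfForm_iff_of_coe_eq_upperUnipotent σ hσ hn).1 hnU
  -- `−a = −σa`: the `N`-factor commutes with `u` iff its super-diagonal entries are `a, −a`, and unitarity makes the second one `−σa`
  have ha : σ ((G 0 0)⁻¹ * G 0 1) = (G 0 0)⁻¹ * G 0 1 := by linear_combination hc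
  refine ⟨G 0 0, (G 0 0)⁻¹ * G 0 1, (G 0 0)⁻¹ * G 0 2, hz, ha, hb, ?_⟩
  rw [ha]
  ext i j
  fin_cases i <;> fin_cases j <;> simp [h10, h20, h21, h11, h22, h12, hz0]

/-- **CONVERSELY**, for `σ` an involution: `z • u(a, b)` with `σz·z = 1`, `σa = a`, `b + σb + aσa = 0` lies in `U(σ, J₀)` and commutes with the regular unipotent
`u = u(1, −t₀)` (unitarity: `z·1 ∈ U` by ★ `diagonal_mem_unitaryGroupOfForm_three_iff`, `u(a, b) ∈ U` by ★ `mem_unitaryGroupOfForm_iff_of_coe_eq_upperUnipotent`;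
commutation: §1). [cite: Rogawski1990, §3.9 p. 32; §1.10 p. 9] -/
theorem smul_upperUnipotent_mem_unitaryGroupOfForm_and_commute (hσ : ∀ z : K, σ (σ z) = z) {t₀ z a b : K}
    (hz : σ z * z = 1) (ha : σ a = a) (hb : b + σ b + a * σ a = 0) {u g : GL (Fin 3) K}
    (hu : (u : Matrix (Fin 3) (Fin 3) K) = !![1, 1, -t₀; 0, 1, -1; 0, 0, 1])
    (hg : (g : Matrix (Fin 3) (Fin 3) K) = z • !![1, a, b; 0, 1, -σ a; 0, 0, 1]) :
    g ∈ unitaryGroupOfForm σ ((StdForm.antidiagonal 3).over K) ∧ g * u = u * g := by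
  have hz0 : z ≠ 0 := right_ne_zero_of_mul_eq_one hz
  -- `g = diag(z)·u(a, b)` with both factors unitary
  obtain ⟨m, hm, hm'⟩ := exists_units_coe_eq_torusS (K := K) hz0 hz0
  have hmU : m ∈ unitaryGroupOfForm σ ((StdForm.antidiagonal 3).over K) :=
    (diagonal_mem_unitaryGroupOfForm_three_iff σ hm).2 ⟨hz, hz, hz⟩
  obtain ⟨n, hn, -⟩ := exists_units_coe_eq_upperTriangularUnipotent a b (-σ a)
  have hnU : n ∈ unitaryGroupOfForm σ ((StdForm.antidiagonal 3).over K) :=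
    (mem_unitaryGroupOfForm_iff_of_coe_eq_upperUnipotent σ hσ hn).2 ⟨rfl, hb⟩
  have hgmn : g = m * n := Units.ext (by
    rw [Units.val_mul, hg, hm, hn]
    ext i j
    fin_cases i <;> fin_cases j <;> simp [Matrix.diagonal_mul])
  refine ⟨hgmn ▸ mul_mem hmU hnU, Units.ext ?_⟩
  rw [Units.val_mul, Units.val_mul, hu, hg]
  refine (mul_regularUnipotent_eq_regularUnipotent_mul_iff t₀ _).2 ⟨?_, ?_, ?_, ?_, ?_, ?_⟩ <;> simp [ha]

/-- **«`G_u = Z·C_N(u)`» WITH THE FACTORS AS ELEMENTS OF `U(σ, J₀)`** (the shape CENT-BDD consumes): a `g ∈ U(σ, J₀)` commuting with the regular unipotent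
`u = u(1, −t₀)` is `g = s·n` with `s = diag(z, z, z) ∈ U(σ, J₀)` a CENTRAL unitary scalar (`σz·z = 1`) and `n = u(a, b) ∈ N ∩ U(σ, J₀)` (`σa = a`, `b + σb + aσa = 0`)
itself commuting with `u`. [cite: Rogawski1990, §3.9 p. 32; §1.10 p. 9] -/
theorem exists_eq_scalar_mul_upperUnipotent_of_commute_regularUnipotent (hσ : ∀ z : K, σ (σ z) = z) {t₀ : K} {u g : GL (Fin 3) K}
    (hu : (u : Matrix (Fin 3) (Fin 3) K) = !![1, 1, -t₀; 0, 1, -1; 0, 0, 1]) (hg : g ∈ unitaryGroupOfForm σ ((StdForm.antidiagonal 3).over K))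
    (hcomm : g * u = u * g) :
    ∃ (s n : GL (Fin 3) K) (z a b : K), σ z * z = 1 ∧ σ a = a ∧ b + σ b + a * σ a = 0 ∧
      (s : Matrix (Fin 3) (Fin 3) K) = Matrix.diagonal ![z, z, z] ∧ (n : Matrix (Fin 3) (Fin 3) K) = !![1, a, b; 0, 1, -σ a; 0, 0, 1] ∧
      s ∈ unitaryGroupOfForm σ ((StdForm.antidiagonal 3).over K) ∧ n ∈ unitaryGroupOfForm σ ((StdForm.antidiagonal 3).over K) ∧
      g = s * n ∧ n * u = u * n := by
  obtain ⟨z, a, b, hz, ha, hb, hgz⟩ := exists_coe_eq_smul_upperUnipotent_of_commute_regularUnipotent σ hσ hu hg hcomm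
  have hz0 : z ≠ 0 := right_ne_zero_of_mul_eq_one hz
  obtain ⟨m, hm, hm'⟩ := exists_units_coe_eq_torusS (K := K) hz0 hz0
  have hmU : m ∈ unitaryGroupOfForm σ ((StdForm.antidiagonal 3).over K) :=
    (diagonal_mem_unitaryGroupOfForm_three_iff σ hm).2 ⟨hz, hz, hz⟩
  obtain ⟨n, hn, -⟩ := exists_units_coe_eq_upperTriangularUnipotent a b (-σ a)
  -- `n = 1 • u(a, b)`: unitary and commuting with `u` by the converse with `z = 1`
  have hn1 : (n : Matrix (Fin 3) (Fin 3) K) = (1 : K) • !![1, a, b; 0, 1, -σ a; 0, 0, 1] := by rw [one_smul, hn]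
  obtain ⟨hnU, hncomm⟩ := smul_upperUnipotent_mem_unitaryGroupOfForm_and_commute σ hσ (t₀ := t₀) (z := 1) (by rw [map_one, one_mul]) ha hb hu hn1
  have hgmn : g = m * n := Units.ext (by
    rw [Units.val_mul, hgz, hm, hn]
    ext i j
    fin_cases i <;> fin_cases j <;> simp [Matrix.diagonal_mul])
  exact ⟨m, n, z, a, b, hz, ha, hb, hm, hn, hmU, hnU, hgmn, hncomm⟩

end Literature.NumberTheory.Automorphic.UnitaryGroup
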